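import Mathlib
import HarnessLib
import Summits.QuantumAdvantage.QuantumAdvantage.Theorems.PumpDialH
import Summits.QuantumAdvantage.QuantumAdvantage.Theorems.PumpDialK

/-!
# PumpDial L — junction: `X = AbsorptionDial.NoPerfectPolyOdd ⟸ HardToUnityOdd` alone, and `X ↔ HardToUnityOdd`

Lens «minimal-counterexample / extremal reduction» (decomp-qadv-lens-4, generation 26): the TWIST LAW package,
cut into chain-imported parts `PumpDialI → PumpDialJ → PumpDialK` (Theses-free: imports only `PumpDialG`,
`AdviceFreeQNC0.WalkAdaptedFarPattern`, HarnessLib, Mathlib) and the junction `PumpDialL` (imports `PumpDialH`).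
The monolithic file of record (`TwistLaw.lean`, farm rc 0 · 0 sorry · axioms {propext, Classical.choice, Quot.sound})
and the full mathematical header live in the lens folder g26; this part:
the Theses-importing junction (like `PumpDialH`): `closes_of_aK : HardToUnityOdd → NoPerfectPolyOdd` (B_K discharged by
`noUnityHardOdd_holds`) and `noPerfectPolyOdd_iff_hardToUnityOdd` (with `aK_of_target`): the residual of X is exactly A_K.
-/

set_option autoImplicit false
set_option linter.dupNamespace false

namespace Summit.QuantumAdvantage.QuantumAdvantage.Theorems.PumpDial
open Classical
open Finset
open Summit.QuantumAdvantage.AdviceFreeQNC0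
open Literature.Computability.MetaComplexity Literature.Computability.MetaComplexity.Smolensky
open Summit.QuantumAdvantage.QuantumAdvantage.Theses

section X
/-! ## Junction with the route decl (Theses-importing layer, cf. `PumpDialH`)

With `B_K = NoUnityHardOdd` a theorem (`noUnityHardOdd_holds`), the deciding theorem `PumpDialH.closes`
needs only `A_K = HardToUnityOdd`, and `aK_of_target` gives the converse: the crux
`Summit.QuantumAdvantage.QuantumAdvantage.Theses.AbsorptionDial.NoPerfectPolyOdd` is EQUIVALENT to the absorption statement `A_K`. -/

/-- `X ⟸ A_K` alone (B_K discharged by the twist law). -/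
theorem closes_of_aK (hA : HardToUnityOdd) : Summit.QuantumAdvantage.QuantumAdvantage.Theses.AbsorptionDial.NoPerfectPolyOdd :=
  closes hA noUnityHardOdd_holds

/-- the residual of `X` is exactly `A_K`: `Target ↔ HardToUnityOdd`. -/
theorem target_iff_hardToUnityOdd : Target ↔ HardToUnityOdd :=
  ⟨aK_of_target, closes_of_aK⟩

/-- the same with the route decl spelled out. -/
theorem noPerfectPolyOdd_iff_hardToUnityOdd : Summit.QuantumAdvantage.QuantumAdvantage.Theses.AbsorptionDial.NoPerfectPolyOdd ↔ HardToUnityOdd :=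
  target_iff_hardToUnityOdd

end X

end Summit.QuantumAdvantage.QuantumAdvantage.Theorems.PumpDial
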